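import Summits.CriticalPhenomena.SAWScalingLimit.Theorems.SAWLeftRightFKGFKGToTraversalBoundNecklaceAssemblyFarBound
import Summits.CriticalPhenomena.SAWScalingLimit.Theorems.SAWLeftRightFKGFKGToTraversalBoundNecklaceAssemblyFarSpine
import Summits.CriticalPhenomena.SAWScalingLimit.Theorems.SAWLeftRightFKGFKGToTraversalBoundNecklaceAssemblyFarSwallow
import Summits.CriticalPhenomena.SAWScalingLimit.Theorems.SAWLeftRightFKGFKGToTraversalBoundNecklaceAssemblyFarBlobs
import Summits.CriticalPhenomena.SAWScalingLimit.Theorems.SAWLeftRightFKGFKGToTraversalBoundCentreNet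
import Summits.CriticalPhenomena.SAWScalingLimit.Theorems.SAWLeftRightFKGFKGToTraversalBoundHungPresentation
import Summits.CriticalPhenomena.SAWScalingLimit.Theorems.SAWLeftRightFKGFKGToTraversalBoundRadialSplit
import Summits.CriticalPhenomena.SAWScalingLimit.Theorems.SAWLeftRightFKGFKGToTraversalBoundSlitNecklaceFarTipU
import Literature.Probability.LatticeModels.MeshDomainJordan
import HarnessLib

/-!
# Necklace assembly, far-tip form (stub `stub_necklaceAssemblyFarU`, line `slit-necklace`, reshape r4/r4.1): the glue

Crux `SAWLeftRightFKG.FKGToTraversalBound` (stmt-CriticalPhenomena-1878), chart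
`Cruxes/FKGToTraversalBound/Lines/slit-necklace-chart-r4.md` §3, steps A0–A5, over the landed parts
`necklace_rankDescent` (p134980), `hasSepWindows_subshell_pigeonhole` (p135063), `necklace_cascadeSelection`
(p135280), `tamePresentation_attached` (p135403), `necklace_badEvent_le` (p135547),
`necklace_swallowed_noTraversals` (p135601), `necklace_blobs`.

Hypotheses.  `SlotLaw` (p134383) fed with `stub_hungPresentation` (p127603) and the engine currency
`UniformSubshellTight`; `NecklaceBookkeeping` (p130309, unused as a hypothesis: the landed theorem is called);
the far-tip necklace witness in RANK-UNIFORM form (`hNW`: one boundary budget function `nB`, and for every finite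
family of shells, eventually in the mesh, for every presented chord ONE rank on its far pieces serving all the
shells of the family — the form the cascade needs); endpoint approximation, eventual tameness, germ tightness at
both marked points.  Conclusion: `EventualShellTight`.

Constants (fixed from `(D, x, ρ, R, ε)` before the mesh): radial part `T` of the target shell away from the
marked points (`hasTraversals_radial_part`, p130091, applied to a constant curve), working shell `U` one
sixteenth inside `T`; reach `η`; germ thresholds `g`; defect budget `N₀' = 5 N₀`, `M = 2 N₀' + 2 g = H`; scales
`s_h = |U| / 10 / 25^{H-h}`, nets (`exists_centre_net`, p130039), slot-law thresholds by recursion on the level;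
then the finitely many eventualities are intersected and, at a fixed mesh, the defect set is normalised, the
swallowed case is empty, and in the attached case the blobs, `necklace_badEvent_le`, the two germ bounds and the
slot law at every `(h, centre, J)` give `ε/3 + ε/3 + ε/3`.

Only theorems; no named fact; axioms are the standard three.
-/

noncomputable section

open MeasureTheory Filter Topology Set Metric
open scoped NNReal ENNReal
open Literature.Probability.LatticeModels
open Literature.Probability.RandomPlanarGeometry
open Literature.Probability.RandomPlanarGeometry.SAW
open Summit.CriticalPhenomena.SAWScalingLimit.Theorems.FKGToTraversalBound.Negative (dom)

namespace Summit.CriticalPhenomena.SAWScalingLimit.Theorems.FKGToTraversalBound.SlitNecklace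

/-- A real-arithmetic step of the union bound: `N · M · ε / (3 (H+1) (N+1) (M+1)) ≤ ε / (3 (H+1))`.
[folklore] -/
private theorem level_sum_le {ε : ℝ} (hε : 0 ≤ ε) (N M H : ℕ) :
    (N : ℝ) * ((M : ℝ) * (ε / (3 * (H + 1) * (N + 1) * (M + 1)))) ≤ ε / (3 * (H + 1)) := by
  have hN : (0 : ℝ) ≤ N := Nat.cast_nonneg N
  have hM : (0 : ℝ) ≤ M := Nat.cast_nonneg M
  have hH : (0 : ℝ) < 3 * (H + 1) := by positivity
  rw [show (N : ℝ) * ((M : ℝ) * (ε / (3 * (H + 1) * (N + 1) * (M + 1)))) =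
      (N * M / ((N + 1) * (M + 1))) * (ε / (3 * (H + 1))) by field_simp]
  refine mul_le_of_le_one_left (by positivity) ?_
  rw [div_le_one (by positivity)]
  nlinarith

/-- Summing a constant over the centres and the values of `J`. [folklore] -/
private theorem sum_const_ofReal (n m : ℕ) (r : ℝ) :
    ∑ _i : Fin n, ∑ _j ∈ Finset.range m, ENNReal.ofReal r = ENNReal.ofReal (n * (m * r)) := by
  rw [Finset.sum_const, Finset.sum_const, Finset.card_univ, Fintype.card_fin, Finset.card_range, nsmul_eq_mul,
    nsmul_eq_mul, ENNReal.ofReal_mul (Nat.cast_nonneg n), ENNReal.ofReal_mul (Nat.cast_nonneg m),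
    ENNReal.ofReal_natCast, ENNReal.ofReal_natCast]

set_option maxHeartbeats 800000 in
/-- **The necklace assembly in far-tip form, from the rank-uniform witness** (glue of the registered stub
`stub_necklaceAssemblyFar` after reshape; see the module docstring). [folklore] -/
theorem necklaceAssemblyFar_of_uniformRank :
    SlotLaw → NecklaceBookkeeping →
    (∀ (D : DobrushinDomain), ∃ nB : ℂ → ℝ → ℝ → ℕ, ∀ (ι : Type) [Fintype ι] (y : ι → ℂ) (σ₁ σ₂ : ι → ℝ),
      (∀ t, 0 < σ₁ t ∧ σ₁ t < σ₂ t) → ∀ᶠ δ in 𝓝[>] (0 : ℝ),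
      ∀ (c : Site 2) (C : (zdGraph 2).Walk c c) (S Ka Kb : Finset (Site 2)) (a₀ b₀ : Site 2) (ca cb : ℂ)
        (ιa ιb η : ℝ) (γ : (discreteDomainGraph D.carrier δ).Walk a₀ b₀),
        (∀ x' y' : Site 2, (discreteDomainGraph (dom C δ) δ).Adj x' y' ↔
          ((discreteDomainGraph D.carrier δ).Adj x' y' ∧ x' ∉ S ∧ y' ∉ S)) →
        (∀ k ∈ Ka ∪ Kb ∪ S, ∃ (q : Site 2) (w : (zdGraph 2).Walk k q), q ∈ C.support ∧
          ∀ z ∈ w.support, z ∈ Ka ∪ Kb ∪ S ∨ z ∈ C.support) →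
        γ.IsPath → a₀ ∈ Ka → b₀ ∈ Kb →
        (∀ k ∈ Ka, dist (meshPoint δ k) ca ≤ ιa) → (∀ k ∈ Kb, dist (meshPoint δ k) cb ≤ ιb) →
        ιa + 3 * δ ≤ η → ιb + 3 * δ ≤ η → 2 * η + δ < dist ca cb →
        ∃ rk : ℕ → ℕ,
          (∀ i, rk i ≤ {i' : ℕ | ∃ j', IsFarPiece (meshPoint δ) γ (↑(Ka ∪ Kb ∪ S)) (↑S) i' j' ca cb η}.ncard) ∧
          ∀ t : ι, 4 * δ < σ₂ t - σ₁ t →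
            (∀ z : ℂ, σ₁ t ≤ dist z (y t) → dist z (y t) ≤ σ₂ t → 2 * η ≤ dist z ca ∧ 2 * η ≤ dist z cb) →
            ∀ (i j τ τ' W : ℕ), IsFarTipPiece (meshPoint δ) γ (↑(Ka ∪ Kb ∪ S)) i j τ τ' ca cb η →
              (∀ i' j', IsFarPiece (meshPoint δ) γ (↑(Ka ∪ Kb ∪ S)) (↑S) i' j' ca cb η → rk i' < rk i →
                ¬ HasSepWindows (meshPoint δ) γ (W + 1) (i' + 1) (j' - 1) (y t) (σ₁ t + 2 * δ) (σ₂ t - 2 * δ)) →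
              HasFarTipWitness D.carrier δ (↑(Ka ∪ Kb ∪ S)) γ τ τ'
                (8 * ({i' : ℕ | ∃ j', IsFarPiece (meshPoint δ) γ (↑(Ka ∪ Kb ∪ S)) (↑S) i' j' ca cb η}.ncard
                      + S.card + 2) ^ 2 * (W + nB (y t) (σ₁ t) (σ₂ t) + 2))
                (y t) (σ₁ t) (σ₂ t)) →
    UniformSubshellTight →
    ∀ (D : DobrushinDomain) (a b : ℝ → Site 2), IsEndpointApprox D a b → EventuallyTame D →
      GermTight D a b a → GermTight D a b b → EventualShellTight D a b := by
  intro hSL _hBK hNW hUST D a b hab hTame hGa hGb x ρ R hρ h2ρ hR1 ε hε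
  classical
  -- A0: marked points, radial part `T`, working shell `U`, reach `η`
  set pa := D.pt 0 with hpa
  set pb := D.pt 1 with hpb
  have hpt : pa ≠ pb := fun h => absurd (D.pt_injective h) (by decide : (0 : Fin 2) ≠ 1)
  have hdab : 0 < dist pa pb := dist_pos.2 hpt
  have hηs : 0 < (R - ρ) / 8 := by linarith
  obtain ⟨ρT, RT, hρT, hRT, hw3, hbandT, -⟩ := hasTraversals_radial_part (⟨ContinuousMap.const _ x⟩ : Curve ℂ)
    x pa pb ρ R ((R - ρ) / 8) 0 hηs (by linarith) (Curve.hasTraversals_zero _ _ _ _)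
  set w := RT - ρT with hw
  have hw6 : (R - ρ) / 6 ≤ w := by linarith
  have hwpos : 0 < w := by linarith
  set ρU := ρT + w / 16 with hρU
  set RU := RT - w / 16 with hRU
  have hRU3 : RU ≤ 3 := by linarith
  have hρU0 : 0 ≤ ρU := by linarith
  set η := min ((R - ρ) / 32) (dist pa pb / 8) with hη
  have hηpos : 0 < η := lt_min (by linarith) (by linarith)
  have hη1 : η ≤ (R - ρ) / 32 := min_le_left _ _
  have hη2 : η ≤ dist pa pb / 8 := min_le_right _ _
  -- A1: germ thresholds
  obtain ⟨ga, hga⟩ := hGa η hηpos (ε / 3) (by positivity)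
  obtain ⟨gb, hgb⟩ := hGb η hηpos (ε / 3) (by positivity)
  set g := max ga gb with hg
  -- A2: defect budget
  obtain ⟨N₀, hN₀⟩ := hTame
  -- (opaque names: the unifier must not unfold the arithmetic of the constants)
  obtain ⟨N₀', hN₀'⟩ : ∃ N₀' : ℕ, N₀' = 5 * N₀ := ⟨_, rfl⟩
  obtain ⟨M, hM⟩ : ∃ M : ℕ, M = 2 * N₀' + 2 * g := ⟨_, rfl⟩
  obtain ⟨H, hH⟩ : ∃ H : ℕ, H = M := ⟨_, rfl⟩
  -- A3: scales, nets, budgets, thresholds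
  have hUw : RU - ρU = 7 * w / 8 := by simp only [hρU, hRU]; ring
  obtain ⟨sc, hsc⟩ : ∃ sc : ℕ → ℝ, ∀ h, sc h = (RU - ρU) / 10 / 25 ^ (H - h) := ⟨_, fun h => rfl⟩
  have hsc_pos : ∀ h, 0 < sc h := fun h => by
    rw [hsc]
    exact div_pos (div_pos (by linarith) (by norm_num)) (pow_pos (by norm_num) _)
  have hscH : sc H = (RU - ρU) / 10 := by rw [hsc, Nat.sub_self, pow_zero, div_one]
  have hsc_succ : ∀ h, h < H → sc h = sc (h + 1) / 25 := fun h hh => by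
    rw [hsc, hsc, show H - h = H - (h + 1) + 1 by omega, pow_succ, ← div_div]
  have hsc_mono : ∀ h, sc 0 ≤ sc h := fun h => by
    rw [hsc, hsc, Nat.sub_zero]
    exact div_le_div_of_nonneg_left (div_nonneg (by linarith) (by norm_num)) (pow_pos (by norm_num) _)
      (pow_le_pow_right₀ (by norm_num) (Nat.sub_le H h))
  choose Nn net hnet using fun h => exists_centre_net x 3 (sc h) (hsc_pos h)
  obtain ⟨nB, hnB⟩ := hNW D
  set nBmax : ℕ → ℕ := fun h => Finset.univ.sup fun i : Fin (Nn h) => nB (net h i) (21 * sc h / 16)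
    (27 * sc h / 16) with hnBmax
  set εh : ℕ → ℝ := fun h => ε / (3 * (H + 1) * (Nn h + 1) * (M + 1)) with hεh
  have hεh_pos : ∀ h, 0 < εh h := fun h => by simp only [hεh]; positivity
  have hSLb := hSL stub_hungPresentation hUST
  choose slotN hslotN using fun h n₀ => hSLb (εh h) (hεh_pos h) n₀
  set cost : ℕ → ℕ → ℕ := fun h W => 8 * (M + N₀' + 2) ^ 2 * (W + nBmax h + 2) with hcost
  set Wf : ℕ → ℕ := fun h => Nat.rec (motive := fun _ => ℕ) 0
    (fun h' W => Nn h' * (slotN h' (cost h' W) + 1)) h with hWf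
  have hWfs : ∀ h, Wf (h + 1) = Nn h * (slotN h (cost h (Wf h)) + 1) := fun h => rfl
  set nth : ℕ → ℕ := fun h => slotN h (cost h (Wf h)) with hnth
  set K : ℕ → ℕ := fun h => cost h (Wf h) + 1 with hK
  have hWf_rel : ∀ h, h < H → Nn h * (nth h + 1) ≤ Wf (h + 1) + 1 := fun h _ => by
    rw [hWfs]
    exact Nat.le_succ _
  set nTop := 2 * (N₀' + 2 * g + (2 * N₀' + 2 * g) * (Nn H * (nth H + 1)) + 1) with hnTop
  refine ⟨nTop, ?_⟩
  -- the finitely many eventualities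
  have hev0 : ∀ᶠ δ in 𝓝[>] (0 : ℝ), 0 < δ := eventually_mem_nhdsWithin
  have hclose_a : ∀ᶠ δ in 𝓝[>] (0 : ℝ), dist (meshPoint δ (a δ)) pa < η / 2 :=
    (hab.tendsto_fst.eventually_mem (Metric.ball_mem_nhds _ (half_pos hηpos))).mono fun δ h => h
  have hclose_b : ∀ᶠ δ in 𝓝[>] (0 : ℝ), dist (meshPoint δ (b δ)) pb < η / 2 :=
    (hab.tendsto_snd.eventually_mem (Metric.ball_mem_nhds _ (half_pos hηpos))).mono fun δ h => h
  set δ₀ := min (sc 0 / 40) (η / 12) with hδ₀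
  have hδ₀pos : 0 < δ₀ := lt_min (by linarith [hsc_pos 0]) (by linarith)
  have hsmall : ∀ᶠ δ in 𝓝[>] (0 : ℝ), δ < δ₀ := by
    filter_upwards [Ioo_mem_nhdsGT hδ₀pos] with δ hδ using hδ.2
  have hconn := D.toJordanDomain.eventually_forall_mem_meshDomain' isCompact_empty (Set.empty_subset _)
  -- the shell family of the cascade
  let ι := Σ h : Fin (H + 1), Fin (Nn h)
  set yf : ι → ℂ := fun t => net t.1 t.2 with hyf
  set σ₁f : ι → ℝ := fun t => 21 * sc t.1 / 16 with hσ₁f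
  set σ₂f : ι → ℝ := fun t => 27 * sc t.1 / 16 with hσ₂f
  have hσ : ∀ t : ι, 0 < σ₁f t ∧ σ₁f t < σ₂f t := fun t => by
    have := hsc_pos t.1
    simp only [hσ₁f, hσ₂f]
    constructor <;> linarith
  have hwitEv := hnB ι yf σ₁f σ₂f hσ
  filter_upwards [hev0, hN₀, hab.reachable, hclose_a, hclose_b, hga, hgb, hwitEv, hsmall, hconn] with δ hδ
    htame hreach hca hcb hGa' hGb' hwit hδsmall hconn'
  -- at a fixed mesh
  have hδ40 : 40 * δ ≤ sc 0 := by
    have : δ₀ ≤ sc 0 / 40 := min_le_left _ _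
    linarith only [this, hδsmall]
  have hδη : 12 * δ ≤ η := by
    have : δ₀ ≤ η / 12 := min_le_right _ _
    linarith only [this, hδsmall]
  have hδsc : ∀ h, 40 * δ ≤ sc h := fun h => hδ40.trans (hsc_mono h)
  have hδw : 40 * δ ≤ 7 * w / 80 := by
    have := hδsc H
    rw [hscH, hUw] at this
    linarith only [this]
  set ca := meshPoint δ (a δ) with hca_def
  set cb := meshPoint δ (b δ) with hcb_def
  have hab_ne : a δ ≠ b δ := by
    intro h
    have hca' : dist (meshPoint δ (a δ)) pa < η / 2 := hca
    have hcb' : dist (meshPoint δ (b δ)) pb < η / 2 := hcb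
    rw [h] at hca'
    have := dist_triangle pa (meshPoint δ (b δ)) pb
    have h2 := dist_comm pa (meshPoint δ (b δ))
    linarith only [this, h2, hca', hcb', hη2, hdab]
  -- presentation, normalised
  obtain ⟨c, C, S₀, hS₀, hid₀⟩ := htame
  obtain ⟨S', hS'card, hid, hcl, hdich⟩ := tamePresentation_attached D.carrier δ c C S₀ hδ.ne' hid₀
  have hS' : S'.card ≤ N₀' := hS'card.trans (by omega)
  -- both endpoints carry an edge of `D_δ`
  obtain ⟨p⟩ := hreach
  have hplen : 0 < p.length := by
    by_contra h0
    exact hab_ne (p.eq_of_length_eq_zero (by omega))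
  have hadjA : ∃ w', (discreteDomainGraph D.carrier δ).Adj (a δ) w' :=
    ⟨_, by have := p.adj_getVert_succ hplen; rwa [SimpleGraph.Walk.getVert_zero] at this⟩
  have hadjB : ∃ w', (discreteDomainGraph D.carrier δ).Adj (b δ) w' :=
    ⟨_, by
      have := p.reverse.adj_getVert_succ (by rwa [SimpleGraph.Walk.length_reverse])
      rwa [SimpleGraph.Walk.getVert_zero] at this⟩
  -- the target event inside the working-shell event
  have hincl : {γ : DomainSAW D.carrier δ (a δ) (b δ) | (polyline γ).HasTraversals nTop x ρ R} ⊆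
      {γ | (polyline γ).HasTraversals nTop x ρU RU} := fun γ hγ =>
    (Curve.HasTraversals.mono' hγ hρT hRT).mono' (by linarith only [hρU, hwpos]) (by linarith only [hRU, hwpos])
  have hρδ : ρU + δ < RU - δ := by linarith only [hρU, hRU, hw, hδw, hwpos]
  rcases hdich with hatt | ⟨k, hk, hsw⟩
  swap
  · -- the swallowed case: no chord makes that many traversals
    have hnTop_ge : 2 * (S'.card + 1) ≤ nTop := by
      simp only [hnTop]
      generalize (2 * N₀' + 2 * g) * (Nn H * (nth H + 1)) = P
      omega
    have hempty : {γ : DomainSAW D.carrier δ (a δ) (b δ) | (polyline γ).HasTraversals nTop x ρU RU} ⊆ ∅ :=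
      fun γ hγ => necklace_swallowed_noTraversals D.carrier δ S' k (a δ) (b δ) γ x ρU RU hδ.le hρδ hconn'.2 hk
        hsw (hγ.of_le hnTop_ge)
    calc law D.carrier δ (a δ) (b δ) {γ | (polyline γ).HasTraversals nTop x ρ R}
        ≤ law D.carrier δ (a δ) (b δ) ∅ := measure_mono (hincl.trans hempty)
      _ ≤ ENNReal.ofReal ε := by rw [measure_empty]; exact zero_le
  -- the attached case: blobs and the spine
  obtain ⟨Ka, Kb, haKa, hbKb, hrada, hradb, hattach⟩ :=
    necklace_blobs D δ c C S' (a δ) (b δ) hδ hid hcl hatt hadjA hadjB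
  set ιa := infDist ca D.carrierᶜ + 3 * δ with hιa_def
  set ιb := infDist cb D.carrierᶜ + 3 * δ with hιb_def
  have hfr_out : ∀ i : Fin 2, D.pt i ∈ D.carrierᶜ := fun i hmem => by
    have h := D.isOpen.inter_frontier_eq
    exact (Set.ext_iff.1 h (D.pt i)).1 ⟨hmem, D.pt_mem_frontier i⟩
  have hca' : dist ca pa < η / 2 := hca
  have hcb' : dist cb pb < η / 2 := hcb
  have hinfa : infDist ca D.carrierᶜ ≤ dist ca pa := infDist_le_dist_of_mem (hfr_out 0)
  have hinfb : infDist cb D.carrierᶜ ≤ dist cb pb := infDist_le_dist_of_mem (hfr_out 1)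
  have hιa : ιa + 3 * δ ≤ η := by simp only [hιa_def]; linarith only [hinfa, hca', hδη]
  have hιb : ιb + 3 * δ ≤ η := by simp only [hιb_def]; linarith only [hinfb, hcb', hδη]
  have hcacb : 2 * η + δ < dist ca cb := by
    have := dist_triangle4 pa ca cb pb
    rw [dist_comm pa ca] at this
    linarith only [this, hca', hcb', hη2, hδη, hηpos]
  have hfarU : ∀ z : ℂ, ρU - δ ≤ dist z x → dist z x ≤ RU + δ → 2 * η ≤ dist z ca ∧ 2 * η ≤ dist z cb := by
    intro z hz₁ hz₂
    have hzT := hbandT z (by linarith only [hz₁, hρU, hδw, hwpos]) (by linarith only [hz₂, hRU, hδw, hwpos])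
    have t1 := dist_triangle z ca pa
    have t2 := dist_triangle z cb pb
    constructor
    · linarith only [hzT.1, t1, hca', hη1, hηpos]
    · linarith only [hzT.2, t2, hcb', hη1, hηpos]
  -- all the real arithmetic of this mesh, before any large statement enters the context
  have hιa' : ιa < η := by linarith only [hιa, hδ]
  have hιb' : ιb < η := by linarith only [hιb, hδ]
  have h2ηU : 2 * η + δ ≤ RU - ρU := by linarith only [hη1, hw6, hδw, hUw, hwpos]
  have hs32' : ∀ h, h ≤ H → 32 * δ ≤ sc h := fun h _ => by linarith only [hδsc h, hδ]
  have hscale' : ∀ h, h < H → 5 * sc h + 2 * δ ≤ sc (h + 1) / 4 := fun h hh => by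
    rw [hsc_succ h hh]; linarith only [hδsc (h + 1)]
  have hsH' : 5 * sc H + 4 * δ ≤ RU - ρU := by rw [hscH]; linarith only [hUw, hδw, hwpos]
  have hHM : 2 * N₀' + 2 * g ≤ H := by omega
  have hιa2 : ιa ≤ 2 * infDist ca D.carrierᶜ + 4 * δ := by
    simp only [hιa_def]; linarith only [infDist_nonneg (x := ca) (s := D.carrierᶜ), hδ]
  have hιb2 : ιb ≤ 2 * infDist cb D.carrierᶜ + 4 * δ := by
    simp only [hιb_def]; linarith only [infDist_nonneg (x := cb) (s := D.carrierᶜ), hδ]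
  have hslot : ∀ h, δ ≤ sc h ∧ (3 * sc h + 2 * sc h) / 4 + δ ≤ 21 * sc h / 16 ∧
      21 * sc h / 16 < 27 * sc h / 16 ∧ 27 * sc h / 16 ≤ (sc h + 3 * (2 * sc h)) / 4 - δ := fun h => by
    have hs := hsc_pos h
    have h40 := hδsc h
    exact ⟨by linarith only [hs, h40], by linarith only [hs, h40], by linarith only [hs, h40],
      by linarith only [hs, h40]⟩
  have hwit4 : ∀ h, 4 * δ < 27 * sc h / 16 - 21 * sc h / 16 := fun h => by
    linarith only [hδsc h, hsc_pos h]
  have hadm_band : ∀ (h : ℕ) (cc z : ℂ), ρU + 2 * sc h ≤ dist cc x → dist cc x ≤ RU - 2 * sc h →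
      21 * sc h / 16 ≤ dist z cc → dist z cc ≤ 27 * sc h / 16 → 2 * η ≤ dist z ca ∧ 2 * η ≤ dist z cb := by
    intro h cc z h1 h2 h3 h4
    have hs := hsc_pos h
    have t1 := dist_triangle z cc x
    have t2 := dist_triangle cc z x
    rw [dist_comm cc z] at t2
    exact hfarU z (by linarith only [hs, h1, h4, t2, hδ]) (by linarith only [hs, h2, h4, t1, hδ])
  have hε3 : 0 ≤ ε / 3 := by positivity
  -- the rank-uniform witness at the cascade shells, with budgets bounded by `K h`
  have hWglue : ∀ γ : DomainSAW D.carrier δ (a δ) (b δ),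
      {i' : ℕ | ∃ j', IsFarPiece (meshPoint δ) γ.walk (↑(Ka ∪ Kb ∪ S')) (↑S') i' j' ca cb η}.ncard < 2 * N₀' + 2 * g →
      ∃ rk : ℕ → ℕ,
        (∀ i, rk i ≤ {i' : ℕ | ∃ j', IsFarPiece (meshPoint δ) γ.walk (↑(Ka ∪ Kb ∪ S')) (↑S') i' j' ca cb η}.ncard) ∧
        ∀ (h : ℕ) (i₁ : Fin (Nn h)) (i j τ τ' : ℕ), h ≤ H →
          ρU + 2 * sc h ≤ dist (net h i₁) x → dist (net h i₁) x ≤ RU - 2 * sc h →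
          IsFarTipPiece (meshPoint δ) γ.walk (↑(Ka ∪ Kb ∪ S')) i j τ τ' ca cb η →
          (∀ i' j', IsFarPiece (meshPoint δ) γ.walk (↑(Ka ∪ Kb ∪ S')) (↑S') i' j' ca cb η → rk i' < rk i →
            ¬ HasSepWindows (meshPoint δ) γ.walk (Wf h + 1) (i' + 1) (j' - 1) (net h i₁)
              (21 * sc h / 16 + 2 * δ) (27 * sc h / 16 - 2 * δ)) →
          HasFarTipWitness D.carrier δ (↑(Ka ∪ Kb ∪ S')) γ.walk τ τ' (K h) (net h i₁) (21 * sc h / 16)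
            (27 * sc h / 16) := by
    intro γ hcount
    obtain ⟨rk, hrk, hwt⟩ := hwit c C S' Ka Kb (a δ) (b δ) ca cb ιa ιb η γ.walk hid hattach γ.isPath haKa hbKb
      hrada hradb hιa hιb hcacb
    refine ⟨rk, hrk, fun h i₁ i j τ τ' hh hadm₁ hadm₂ hft hlow => ?_⟩
    have key := hwt ⟨⟨h, Nat.lt_succ_of_le hh⟩, i₁⟩ (hwit4 h)
      (fun z hz₁ hz₂ => hadm_band h (net h i₁) z hadm₁ hadm₂ hz₁ hz₂) i j τ τ' (Wf h) hft hlow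
    refine key.mono ?_
    have hnb : nB (net h i₁) (21 * sc h / 16) (27 * sc h / 16) ≤ nBmax h :=
      Finset.le_sup (f := fun i : Fin (Nn h) => nB (net h i) (21 * sc h / 16) (27 * sc h / 16))
        (Finset.mem_univ i₁)
    have hbase : {i' : ℕ | ∃ j', IsFarPiece (meshPoint δ) γ.walk (↑(Ka ∪ Kb ∪ S')) (↑S') i' j' ca cb η}.ncard
        + S'.card + 2 ≤ M + N₀' + 2 := by omega
    calc 8 * ({i' : ℕ | ∃ j', IsFarPiece (meshPoint δ) γ.walk (↑(Ka ∪ Kb ∪ S')) (↑S') i' j' ca cb η}.ncard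
            + S'.card + 2) ^ 2 * (Wf h + nB (net h i₁) (21 * sc h / 16) (27 * sc h / 16) + 2)
        ≤ 8 * (M + N₀' + 2) ^ 2 * (Wf h + nBmax h + 2) :=
          Nat.mul_le_mul (Nat.mul_le_mul_left 8 (Nat.pow_le_pow_left hbase 2)) (by omega)
      _ ≤ K h := Nat.le_succ _
  -- the two germ terms
  have hGa_le : law D.carrier δ (a δ) (b δ) {γ | (polyline γ).HasTraversals g ca ιa η} ≤ ENNReal.ofReal (ε / 3) := by
    refine (measure_mono fun γ hγ => ?_).trans hGa'
    exact (Curve.HasTraversals.of_le hγ (le_max_left _ _)).mono' hιa2 le_rfl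
  have hGb_le : law D.carrier δ (a δ) (b δ) {γ | (polyline γ).HasTraversals g cb ιb η} ≤ ENNReal.ofReal (ε / 3) := by
    refine (measure_mono fun γ hγ => ?_).trans hGb'
    exact (Curve.HasTraversals.of_le hγ (le_max_right _ _)).mono' hιb2 le_rfl
  -- the slot-law terms
  have hE_le : ∀ h, h ≤ H → ∀ (i₁ : Fin (Nn h)) (J : ℕ),
      law D.carrier δ (a δ) (b δ) {γ | ∃ i j τ τ' : ℕ,
          IsFarTipPiece (meshPoint δ) γ.walk (↑(Ka ∪ Kb ∪ S')) i j τ τ' ca cb η ∧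
          {i' : ℕ | i' < i ∧ ∃ j' τ₁ τ₁',
              IsFarTipPiece (meshPoint δ) γ.walk (↑(Ka ∪ Kb ∪ S')) i' j' τ₁ τ₁' ca cb η}.ncard = J ∧
          HasSepWindows (meshPoint δ) γ.walk (nth h) τ τ' (net h i₁) (sc h) (2 * sc h) ∧
          HasFarTipWitness D.carrier δ (↑(Ka ∪ Kb ∪ S')) γ.walk τ τ' (K h) (net h i₁) (21 * sc h / 16)
            (27 * sc h / 16)} ≤ ENNReal.ofReal (εh h) := by
    intro h _ i₁ J
    obtain ⟨h1, h2, h3, h4⟩ := hslot h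
    exact hslotN h (cost h (Wf h)) D δ c C S' Ka Kb (a δ) (b δ) ca cb η (net h i₁) (sc h) (2 * sc h)
      (21 * sc h / 16) (27 * sc h / 16) J hδ hid hattach haKa hbKb h1 le_rfl h2 h3 h4
  have hsum : ∑ h ∈ Finset.range (H + 1), ∑ i₁ : Fin (Nn h), ∑ J ∈ Finset.range (2 * N₀' + 2 * g),
      law D.carrier δ (a δ) (b δ) {γ | ∃ i j τ τ' : ℕ,
          IsFarTipPiece (meshPoint δ) γ.walk (↑(Ka ∪ Kb ∪ S')) i j τ τ' ca cb η ∧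
          {i' : ℕ | i' < i ∧ ∃ j' τ₁ τ₁',
              IsFarTipPiece (meshPoint δ) γ.walk (↑(Ka ∪ Kb ∪ S')) i' j' τ₁ τ₁' ca cb η}.ncard = J ∧
          HasSepWindows (meshPoint δ) γ.walk (nth h) τ τ' (net h i₁) (sc h) (2 * sc h) ∧
          HasFarTipWitness D.carrier δ (↑(Ka ∪ Kb ∪ S')) γ.walk τ τ' (K h) (net h i₁) (21 * sc h / 16)
            (27 * sc h / 16)} ≤ ENNReal.ofReal (ε / 3) := by
    calc _ ≤ ∑ h ∈ Finset.range (H + 1), ∑ _i₁ : Fin (Nn h), ∑ _J ∈ Finset.range (2 * N₀' + 2 * g),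
          ENNReal.ofReal (εh h) :=
          Finset.sum_le_sum fun h hh => Finset.sum_le_sum fun i₁ _ => Finset.sum_le_sum fun J _ =>
            hE_le h (Nat.lt_succ_iff.1 (Finset.mem_range.1 hh)) i₁ J
      _ = ∑ h ∈ Finset.range (H + 1), ENNReal.ofReal ((Nn h : ℝ) * ((M : ℝ) * εh h)) :=
          Finset.sum_congr rfl fun h _ => by rw [sum_const_ofReal, hM, Nat.cast_add, Nat.cast_mul, Nat.cast_mul, Nat.cast_two]
      _ ≤ ∑ _h ∈ Finset.range (H + 1), ENNReal.ofReal (ε / (3 * (H + 1))) :=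
          Finset.sum_le_sum fun h _ => ENNReal.ofReal_le_ofReal (by
            simp only [hεh]
            exact level_sum_le hε.le (Nn h) M H)
      _ = ENNReal.ofReal (ε / 3) := by
          rw [Finset.sum_const, Finset.card_range, nsmul_eq_mul, ← ENNReal.ofReal_natCast,
            ← ENNReal.ofReal_mul (Nat.cast_nonneg _)]
          congr 1
          push_cast
          field_simp
  -- the union bound at this mesh
  have hbound := necklace_badEvent_le D.carrier δ Ka Kb S' (a δ) (b δ) ca cb x ιa ιb η ρU RU g N₀' H sc Nn net
    nth Wf K hδ haKa hbKb hrada hradb hS' hιa' hιb' h2ηU hRU3 hρU0 hfarU (fun h _ => hsc_pos h) hs32' hscale'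
    hsH' (fun h _ m hm => hnet h m hm) hWf_rel hHM hWglue
  -- conclusion
  calc law D.carrier δ (a δ) (b δ) {γ | (polyline γ).HasTraversals nTop x ρ R}
      ≤ law D.carrier δ (a δ) (b δ) {γ | (polyline γ).HasTraversals nTop x ρU RU} := measure_mono hincl
    _ ≤ _ := hbound
    _ ≤ ENNReal.ofReal (ε / 3) + ENNReal.ofReal (ε / 3) + ENNReal.ofReal (ε / 3) :=
        add_le_add (add_le_add hGa_le hGb_le) hsum
    _ = ENNReal.ofReal ε := by
        rw [← ENNReal.ofReal_add hε3 hε3, ← ENNReal.ofReal_add (add_nonneg hε3 hε3) hε3]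
        congr 1
        ring

/-- **Registered stub `stub_necklaceAssemblyFarU`** (crux stmt-CriticalPhenomena-1878, line `slit-necklace`, reshape r4.1,
STUB 5d): **the necklace assembly in far-tip form** — the slot law, the necklace bookkeeping, the rank-uniform far-tip
witness and the engine currency give, for every endpoint approximation of an eventually tame domain with germ tightness
at both marked points, per-shell eventual tightness.  Glue over `necklaceAssemblyFar_of_uniformRank` (the hypothesis
`NecklaceWitnessFarU` unfolds to its rank-uniform witness clause). -/
theorem stub_necklaceAssemblyFarU :
    SlotLaw → NecklaceBookkeeping → NecklaceWitnessFarU → UniformSubshellTight →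
      ∀ (D : DobrushinDomain) (a b : ℝ → Site 2), IsEndpointApprox D a b → EventuallyTame D →
        GermTight D a b a → GermTight D a b b → EventualShellTight D a b :=
  fun hSL hBK hNWU hUST => necklaceAssemblyFar_of_uniformRank hSL hBK hNWU hUST

end Summit.CriticalPhenomena.SAWScalingLimit.Theorems.FKGToTraversalBound.SlitNecklace

end
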